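import Summits.CriticalPhenomena.Ising3DConformalLimit.Theses.LatticeSDPCertificates

/-!
# CriticalPhenomena / Ising3DConformalLimit — route LatticeSDPCertificates, assembly

Settles item `stmt-CriticalPhenomena-5510` (rank 1, assembly of route
`route-CriticalPhenomena-LatticeSDPCertificates`):

`CertifiedWindow → CriticalStateFeasible → WindowForcesU4 → MoebiusLimit → Ising3DConformalLimit`.

Pure glue over the summit's structure predicates
(`Literature/Probability/LatticeModels/ScalingLimit3D.lean`): `MoebiusLimit` supplies
`ρ, Δ, S` with the pointwise scaling limit, non-degeneracy and Möbius covariance; clause (iii)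
`HasNontrivialU4 S` comes from `WindowForcesU4` once WINDOW
(`c (n/m)^(-(3/2-ε)) G(m e₁) ≤ G(n e₁)` for `1 ≤ m ≤ n`, `G = criticalTwoPoint 3`) is known, and
WINDOW is `CertifiedWindow ∘ CriticalStateFeasible`: from `CriticalStateFeasible` take the window
constants `c_w, C_w`; `CertifiedWindow` answers with `(ε, c, k)`; for `1 ≤ m ≤ n` take the level
`L = k·n` boundary law `ν` of `CriticalStateFeasible`, whose level-`L` mixture functional satisfies
every hypothesis row, apply `CertifiedWindow` at `R = n`, and rewrite
`E{0, j e₁} = criticalTwoPoint 3 (j e₁)` for `j = m, n` (both lie in `Λ_{kn}` since `k ≥ 1`).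
No named facts are used; the theorem is unconditional bookkeeping (same argument as the route's
deciding theorem `closes`).
-/

namespace Summit.CriticalPhenomena.Ising3DConformalLimit.Theorems

open Summit.CriticalPhenomena.Ising3DConformalLimit.Theses.LatticeSDPCertificates
open Literature.Probability.LatticeModels

/-- The axial point `j e₁ = Pi.single 0 j` lies in the box `Λ_N` whenever `j ≤ N`. -/
theorem latticeSDPCertificates_assembly_single_mem_box (N j : ℕ) (hj : j ≤ N) :
    (Pi.single 0 (j : ℤ) : Site 3) ∈ box 3 N := by
  rw [mem_box]
  intro i
  by_cases hi : i = 0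
  · subst hi
    simp only [Pi.single_eq_same]
    omega
  · simp only [Pi.single_eq_of_ne hi]
    omega

/-- The axial point `j e₁ = Pi.single 0 j` is nonzero for `j ≥ 1`. -/
theorem latticeSDPCertificates_assembly_single_ne_zero (j : ℕ) (hj : 1 ≤ j) :
    (Pi.single 0 (j : ℤ) : Site 3) ≠ 0 := by
  intro h
  have h0 := congr_fun h 0
  simp only [Pi.single_eq_same, Pi.zero_apply] at h0
  omega

/-- WINDOW for the axial critical two-point function from
`CertifiedWindow ∘ CriticalStateFeasible`: the antecedent of `WindowForcesU4`
(verbatim the definiens of the support item `WindowBelowHalf`). -/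
theorem latticeSDPCertificates_assembly_window (hCW : CertifiedWindow)
    (hF : CriticalStateFeasible) :
    ∃ ε c : ℝ, 0 < ε ∧ 0 < c ∧ ∀ m n : ℕ, 1 ≤ m → m ≤ n →
      c * ((n : ℝ) / m) ^ (-((3:ℝ) / 2 - ε)) * criticalTwoPoint 3 (Pi.single 0 (m : ℤ)) ≤
        criticalTwoPoint 3 (Pi.single 0 (n : ℤ)) := by
  obtain ⟨cw, Cw, hcw, hCw, hFL⟩ := hF
  obtain ⟨ε, c, k, hε, hc, hk, hR⟩ := hCW cw Cw hcw hCw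
  refine ⟨ε, c, hε, hc, fun m n hm hmn => ?_⟩
  obtain ⟨ν, hν, hrows, hEq⟩ := hFL (k * n)
  have hkn : n ≤ k * n :=
    calc n = 1 * n := (one_mul n).symm
      _ ≤ k * n := Nat.mul_le_mul hk (le_refl n)
  have hwin : c * ((n : ℝ) / m) ^ (-((3:ℝ) / 2 - ε)) *
      (∫ η, isingCorr (zdGraph 3) (box 3 (k * n)) (criticalBeta 3) 0
        (BoundaryCondition.fixed η) {0, Pi.single 0 (m : ℤ)} ∂ν) ≤
      ∫ η, isingCorr (zdGraph 3) (box 3 (k * n)) (criticalBeta 3) 0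
        (BoundaryCondition.fixed η) {0, Pi.single 0 (n : ℤ)} ∂ν :=
    hR n ν hν hrows m n hm hmn le_rfl
  have hEm : (∫ η, isingCorr (zdGraph 3) (box 3 (k * n)) (criticalBeta 3) 0
        (BoundaryCondition.fixed η) {0, Pi.single 0 (m : ℤ)} ∂ν) =
      criticalTwoPoint 3 (Pi.single 0 (m : ℤ)) :=
    hEq _ (latticeSDPCertificates_assembly_single_mem_box (k * n) m (hmn.trans hkn))
      (latticeSDPCertificates_assembly_single_ne_zero m hm)
  have hEn : (∫ η, isingCorr (zdGraph 3) (box 3 (k * n)) (criticalBeta 3) 0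
        (BoundaryCondition.fixed η) {0, Pi.single 0 (n : ℤ)} ∂ν) =
      criticalTwoPoint 3 (Pi.single 0 (n : ℤ)) :=
    hEq _ (latticeSDPCertificates_assembly_single_mem_box (k * n) n hkn)
      (latticeSDPCertificates_assembly_single_ne_zero n (hm.trans hmn))
  rw [hEm, hEn] at hwin
  exact hwin

/-- Settles `stmt-CriticalPhenomena-5510` (exact signature): the assembly
`CertifiedWindow → CriticalStateFeasible → WindowForcesU4 → MoebiusLimit → Ising3DConformalLimit`
of route LatticeSDPCertificates.
Proof: `ρ, Δ, S` with limit, non-degeneracy and Möbius covariance from `MoebiusLimit`;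
WINDOW from `CertifiedWindow ∘ CriticalStateFeasible`
(`latticeSDPCertificates_assembly_window`); `WindowForcesU4` turns WINDOW into `U₄ ≢ 0` for the
non-degenerate limit `(ρ, S)`; together these are `CritIsing3DConformalLimit`
(= `Ising3DConformalLimit`). [folklore] -/
theorem latticeSDPCertificates_assembly_proof :
    Summit.CriticalPhenomena.Ising3DConformalLimit.Theses.LatticeSDPCertificates.Assembly := by
  unfold Assembly
  intro hCW hF hU4 hM
  obtain ⟨ρ, Δ, S, hρ, hΔ, hlim, hnd, hMc⟩ := hM
  have hnt : HasNontrivialU4 S :=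
    hU4 (latticeSDPCertificates_assembly_window hCW hF) ρ S hρ hlim hnd
  exact ⟨ρ, Δ, S, hρ, hΔ, hlim, hnd, hMc, hnt⟩

end Summit.CriticalPhenomena.Ising3DConformalLimit.Theorems
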